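import Literature.Probability.LatticeModels.GibbsTailTriviality
import Literature.Probability.LatticeModels.LebowitzCoexistence
import Literature.Probability.LatticeModels.PlanarIsingCriticalBeta
import Literature.Probability.LatticeModels.SharpnessProofs
import HarnessLib

/-!
# Aizenman–Higuchi from translation invariance of the extremal states (Georgii–Higuchi 2000, §5 ⇒ Thm.)

Topic `Probability/LatticeModels`; theorems only. Georgii–Higuchi, J. Math. Phys. 41 (2000), §5:
"Proposition 5.1 (Absence of non-periodic phases). Any Gibbs measure `μ ∈ 𝒢` is invariant under
translations … Together with Corollary 3.2 this will immediately imply the main theorem that each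
Gibbs measure is a mixture of the two phases `μ⁺` and `μ⁻`." Prop. 5.1 is proved there for an
extremal (tail-trivial) `μ` and extends to all of `𝒢` by extremal decomposition.

This file performs exactly that assembly, with Corollary 3.2 (periodic Gibbs measures are mixtures)
supplied by the tree's **Lebowitz 1977** theorem
`translationInvariant_eq_mixture_of_nn_freeCorr_eq_plusCorr` (`LebowitzCoexistence.lean`), whose
one external input — equality of the free and plus nearest-neighbour energies — is, on `ℤ²` above
`β_c(2) = ½ log(1+√2)` (`criticalBeta_two_holds`), the tree's discharged BGJS identity
`twoPointFree_eq_twoPointPlus_of_criticalBetaTwo_lt_holds` (`PlanarIsingCriticalBeta.lean`):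

* `isTranslationInvariantMeasure_of_ae_tail` — **extremal decomposition step**: if `μ`-almost
  every tail-conditioned state `π^ω = condExpKernel μ 𝒯 ω` is translation invariant, so is `μ`
  (barycentre formula `μ = ∫ π^ω μ(dω)`, `bind_condExpKernel_tail`);
* `nn_freeCorr_eq_plusCorr_two` — `⟨σ_0σ_{eᵢ}⟩^∅_{β,0} = ⟨σ_0σ_{eᵢ}⟩⁺_{β,0}` on `ℤ²` for `β > β_c(2)`;
* `translationInvariant_eq_mixture_two` — Cor. 3.2 for translation invariant `μ ∈ 𝒢(β,0)` on `ℤ²`,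
  `β > β_c(2)` (Lebowitz + BGJS);
* **`aizenman_higuchi_of_tailTrivial_translationInvariant`** — the named fact `aizenman_higuchi`
  (`GibbsStates.lean`) at `β` follows from Prop. 5.1 at `β` in the form "every tail-trivial
  `μ ∈ 𝒢(β, 0)` on `ℤ²` is translation invariant".

## References

* H.-O. Georgii, Y. Higuchi, J. Math. Phys. 41 (2000) 1153–1169, Prop. 5.1, Cor. 3.2 and the
  sentence following Prop. 5.1 (p. 12) [GeorgiiHiguchi2000].
* J. L. Lebowitz, J. Stat. Phys. 16 (1977) 463–476, Thm. 3 [Lebowitz1977].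
* G. Benettin, G. Gallavotti, G. Jona-Lasinio, A. L. Stella, Comm. Math. Phys. 30 (1973) 45–54,
  eq. (3.10) [BenettinGallavottiJonaLasinioStella1973].
* H.-O. Georgii, *Gibbs Measures and Phase Transitions* (2011), Thm. 7.26 [Georgii2011].
-/

noncomputable section

open MeasureTheory ProbabilityTheory Filter
open scoped ENNReal ProbabilityTheory

namespace Literature.Probability.LatticeModels

/-! ### Extremal decomposition step -/

section Decomposition

variable {d : ℕ}

/-- **Translation invariance passes from the tail-conditioned states to the state** (the step "by
the extremal decomposition theorem" after Georgii–Higuchi 2000, Prop. 5.1): if `μ` is a finite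
measure on `{±1}^{ℤ^d}` and `μ`-a.e. `π^ω = condExpKernel μ 𝒯 ω` is translation invariant, then
`μ` is translation invariant, since `μ = ∫ π^ω μ(dω)`. [cite: GeorgiiHiguchi2000, Prop. 5.1 (and the remark following it, p. 12)] [cite: Georgii2011, Thm. 7.26] -/
theorem isTranslationInvariantMeasure_of_ae_tail {μ : Measure (SpinConfig (Site d))} [IsFiniteMeasure μ]
    (h : ∀ᵐ ω ∂μ, IsTranslationInvariantMeasure (condExpKernel μ (tailEvents (Site d) ℤˣ) ω)) :
    IsTranslationInvariantMeasure μ := by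
  intro v
  set κ := condExpKernel μ (tailEvents (Site d) ℤˣ) with hκ
  have hm : tailEvents (Site d) ℤˣ ≤ (MeasurableSpace.pi : MeasurableSpace (SpinConfig (Site d))) :=
    tailEvents_le_pi
  have hmeas : Measurable (κ : SpinConfig (Site d) → Measure (SpinConfig (Site d))) :=
    κ.measurable.mono hm le_rfl
  have hT : Measurable (configShift (S := ℤˣ) v) := (configShift v).measurable
  ext A hA
  rw [Measure.map_apply hT hA]
  conv_rhs => rw [← bind_condExpKernel_tail μ]
  conv_lhs => rw [← bind_condExpKernel_tail μ]
  rw [Measure.bind_apply (hT hA) hmeas.aemeasurable, Measure.bind_apply hA hmeas.aemeasurable]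
  refine lintegral_congr_ae ?_
  filter_upwards [h] with ω hω
  rw [← Measure.map_apply hT hA, hω v]

end Decomposition

/-! ### Corollary 3.2 on `ℤ²` from Lebowitz 1977 and BGJS -/

/-- **Equality of the free and plus nearest-neighbour energies on `ℤ²` above `β_c(2)`**
(BGJS 1973, eq. (3.10), discharged in the tree as `twoPointFree_eq_twoPointPlus_of_criticalBetaTwo_lt_holds`,
with `β_c(2) = ½ log(1+√2)`, `criticalBeta_two_holds`). [cite: BenettinGallavottiJonaLasinioStella1973, §3, eq. (3.10)] -/
theorem nn_freeCorr_eq_plusCorr_two {β : ℝ} (hβ : criticalBeta 2 < β) (i : Fin 2) :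
    freeCorr 2 β 0 {0, Pi.single i 1} = plusCorr 2 β 0 {0, Pi.single i 1} := by
  have hβ' : criticalBetaTwo < β := by rwa [criticalBeta_two_holds] at hβ
  rw [← twoPointFree_eq_freeCorr β (unitVec_ne_zero i),
    ← twoPointPlus_eq_plusCorr β (unitVec_ne_zero i)]
  exact twoPointFree_eq_twoPointPlus_of_criticalBetaTwo_lt_holds hβ' _

/-- **Corollary 3.2 of Georgii–Higuchi 2000 for translation invariant states on `ℤ²`** ("Any
periodic `μ ∈ 𝒢` is a mixture of `μ⁺` and `μ⁻`", here for `ℤ²`-invariant `μ`, the case used after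
Prop. 5.1): for `β > β_c(2)`, every translation invariant `μ ∈ 𝒢(β, 0)` on `ℤ²` is
`t μ⁺ + (1-t) μ⁻`. Proof: Lebowitz 1977, Thm. 3 (tree) with the BGJS energy identity and
`m*(β) > 0` (Peierls, tree). [cite: GeorgiiHiguchi2000, Cor. 3.2] [cite: Lebowitz1977, §3, Thm. 3 and Remark (iii), p. 472] -/
theorem translationInvariant_eq_mixture_two {β : ℝ} (hβ : criticalBeta 2 < β)
    {μ : Measure (SpinConfig (Site 2))} (hμ : μ ∈ isingGibbsMeasures 2 β 0)
    (hμT : IsTranslationInvariantMeasure μ) :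
    ∃ μp μm : Measure (SpinConfig (Site 2)),
      μp ∈ isingGibbsMeasures 2 β 0 ∧ μm ∈ isingGibbsMeasures 2 β 0 ∧
        (∀ A, spinCorr μp A = plusCorr 2 β 0 A) ∧ (∀ A, spinCorr μm A = minusCorr 2 β 0 A) ∧
          ∃ t : ℝ≥0∞, t ≤ 1 ∧ μ = t • μp + (1 - t) • μm := by
  have hd : 2 ≤ 2 := le_rfl
  have hβ0 : 0 < β := (criticalBeta_pos_holds hd).trans hβ
  exact translationInvariant_eq_mixture_of_nn_freeCorr_eq_plusCorr hβ0
    (spontaneousMagnetization_pos_of_criticalBeta_lt_holds hd hβ) (nn_freeCorr_eq_plusCorr_two hβ) hμ hμT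

/-! ### The main theorem from Proposition 5.1 -/

/-- **Aizenman–Higuchi from Georgii–Higuchi's Proposition 5.1** (J. Math. Phys. 41 (2000), p. 12:
"Together with Corollary 3.2 this will immediately imply the main theorem"): at `β > β_c(2)`, if
every tail-trivial `μ ∈ 𝒢(β, 0)` on `ℤ²` is translation invariant (Prop. 5.1 for extremal states),
then the named fact `aizenman_higuchi` holds at `β`: every `μ ∈ 𝒢(β, 0)` is translation invariant
by the extremal decomposition (`isTranslationInvariantMeasure_of_ae_tail` with
`ae_isGibbsMeasure_condExpKernel_tail`, `ae_isTailTrivial_condExpKernel_tail`), hence a mixture of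
the two phases (`translationInvariant_eq_mixture_two`). [cite: GeorgiiHiguchi2000, Prop. 5.1 and Thm. (p. 12)] -/
theorem aizenman_higuchi_of_tailTrivial_translationInvariant {β : ℝ}
    (h51 : criticalBeta 2 < β → ∀ μ ∈ isingGibbsMeasures 2 β 0, IsTailTrivial μ →
      IsTranslationInvariantMeasure μ) :
    aizenman_higuchi (β := β) := by
  intro hβ μ hμ
  have hγ : IsSpecification (isingSpecification (zdGraph 2) β 0) :=
    isSpecification_isingSpecification_zd_holds 2 β 0
  have hμG : IsGibbsMeasure (isingSpecification (zdGraph 2) β 0) μ := hμ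
  haveI := hμG.isProbabilityMeasure
  have hT : IsTranslationInvariantMeasure μ := by
    refine isTranslationInvariantMeasure_of_ae_tail ?_
    filter_upwards [hμG.ae_isGibbsMeasure_condExpKernel_tail hγ,
      hμG.ae_isTailTrivial_condExpKernel_tail hγ] with ω hG ht
    exact h51 hβ _ hG ht
  exact translationInvariant_eq_mixture_two hβ hμ hT

end Literature.Probability.LatticeModels
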